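import Summits.QuantumFields.YangMills.Theses.ForcedResponseSkewness
import Summits.QuantumFields.YangMills.Theorems.ForcedResponseSkewnessFemtoEngineDefs
import Summits.QuantumFields.YangMills.Theorems.ForcedResponseSkewnessFemtoOfFBL6
import Summits.QuantumFields.YangMills.Theorems.ForcedResponseSkewnessResponseLocalisationStubSymContactOfFemto
import Summits.QuantumFields.YangMills.Theorems.ForcedResponseSkewnessResponseLocalisationStubSignedOfSymKernel
import Summits.QuantumFields.YangMills.Theorems.ForcedResponseSkewnessResponseLocalisationSymNearCovOfCentredOsc
import Summits.QuantumFields.YangMills.Theorems.BalabanLadderNTBoundaryLawOscillation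

/-!
# Skeleton «signed-femto-collar» v4 for the RESTATED (rev 6) deciding crux `ResponseLocalisation` (stmt-QuantumFields-26871;
# route `ForcedResponseSkewness`; design width seat frs-p2 g6, lead `ym-line-frs-p1` g4 (A1/A2), g5 (engine form of the AF stub)
# and g6 (engine form of the shared E0′ stub), 2026-08-28)

v4 (lead g6): the shared E0′ stub is registered in ENGINE FORM too — `FBL6OscSigR`, the plane-resolved frozen-boundary law as a
REFERENCE-FREE two-exterior OSCILLATION bound for ONE plaquette orientation at the centre of the centred femto cubes `[-R,R]⁴`
(Defs volume `Theorems/ForcedResponseSkewnessFemtoEngineDefs.lean`; verbatim the hypothesis of the spine's landed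
`Cruxes.NT.BoundaryLaw.fbl6_of_oscillation`, which manufactures the reference values and reaches every cube, site and orientation by
DLR antitonicity, translations and a coordinate permutation).  The registered form `FBL6PinnedSigR` of v1–v3 is now DERIVED below
(`fbl6Pinned_holds`).  With this BOTH physics stubs have one shape — centred cubes along the pinned unit, the centre, two arbitrary
exteriors compared — and the route's whole physics debt outside the residual is the bundle
`FemtoEngineSigR = FBL6OscSigR ∧ CentredOscLawSigR ∧ CentredFemtoLogSigR` (certificate `FemtoEngine.nt_of_femtoEngine`,
file `Theorems/ForcedResponseSkewnessFemtoEngineInterface.lean`).  Everything else as in v3.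

ResponseLocalisation ⇐ stub_fbl6Osc      (E0′/FEMTO engine stub in oscillation form; SHARED with crux 24275 and with the spine's
                                          crux 19353 engine target E1 — same cubes, same field, same shape)
                     + stub_centredOsc   (AF/FEMTO, THE debt, engine form: `CentredOscLawSigR` — centred cubes `[-N,N]⁴`, two
                                          exteriors compared, signed radial sum at the centre ≤ κ/(N+1)⁴ for every κ at a cut R(κ,d₀))
                     + LANDED analysis:  `fbl6_of_oscillation` (spine), `fblPinnedSigR_of_fbl6` (p607908),
                                          `symNearCovLawSigR_of_centredOsc` (g5 p620449), `stub_symContactOfFemto` (frs-p2 p616101),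
                                          `stub_signedOfSymKernel` (frs-p2 p616589).
No summit is proved by any of this (leaf R2a `BalabanLadder.NT`, conditional on the residual 24873; the YM mass gap is NOT proved).
-/

set_option autoImplicit false

noncomputable section

namespace Summit.QuantumFields.YangMills.Cruxes.ResponseLocalisation.SignedFemto

open Summit.QuantumFields.YangMills.Cruxes.ResponseLocalisation.Birth
open Summit.QuantumFields.YangMills.Cruxes.ResponseLocalisation.Femto (fblPinnedSigR_of_fbl6)
open Summit.QuantumFields.YangMills.Cruxes.ResponseLocalisation.Signed (stub_symContactOfFemto stub_signedOfSymKernel)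
open Summit.QuantumFields.YangMills.Cruxes.ResponseLocalisation.CentredOsc (symNearCovLawSigR_of_centredOsc)
open Summit.QuantumFields.YangMills.Cruxes.NT.BoundaryLaw (fbl6_of_oscillation)
open Summit.QuantumFields.YangMills.Theses.ForcedResponseSkewness

/-! ## The registered stubs -/

/-- E0′/FEMTO engine stub in ENGINE FORM (shared with crux 24275 and the spine's crux 19353): the plane-resolved frozen-boundary
law as a reference-free two-exterior oscillation bound for one plaquette orientation at the centre of the centred femto cubes,
along a pinned unit. -/
theorem stub_fbl6Osc : FBL6OscSigR := by
  sorry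

/-- AF/FEMTO stub in ENGINE FORM (the line's debt): the centred, reference-free, two-exterior oscillation law for the signed
radially smeared near-pair conditional covariance along a pinned unit. -/
theorem stub_centredOsc : CentredOscLawSigR := by
  sorry

/-! ## Derived statements (kernel-checked reductions) -/

/-- DERIVED (g6, spine reduction `fbl6_of_oscillation` along the pinned unit): the v1–v3 E0′ stub statement. -/
theorem fbl6Pinned_holds : FBL6PinnedSigR := by
  intro G _ _ _ _ hG
  letI : MeasurableSpace G := borel G
  haveI : BorelSpace G := ⟨rfl⟩
  intro r a hpos hlim hpin
  obtain ⟨D, C₁, β₁, ℓ₁, hℓ₁, H⟩ := stub_fbl6Osc G hG r a hpos hlim hpin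
  exact fbl6_of_oscillation G r a hpos D ⟨C₁, β₁, ℓ₁, hℓ₁, H⟩

/-- DERIVED (g5 reduction, kernel-checked): the former AF stub statement. -/
theorem symNearCovLaw_holds : SymNearCovLawSigR :=
  symNearCovLawSigR_of_centredOsc (fblPinnedSigR_of_fbl6 fbl6Pinned_holds) stub_centredOsc

/-- COMPOSITION (kernel-checked): the rev-6 crux BY NAME; the only `sorry`s are the two PHYSICS stubs. -/
theorem ResponseLocalisation_holds : ResponseLocalisation :=
  stub_signedOfSymKernel (stub_symContactOfFemto (fblPinnedSigR_of_fbl6 fbl6Pinned_holds) symNearCovLaw_holds)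
    (fblPinnedSigR_of_fbl6 fbl6Pinned_holds)

end Summit.QuantumFields.YangMills.Cruxes.ResponseLocalisation.SignedFemto

end
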